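import Literature.IUT.HodgeTheaters.GenuineFKitOfBadLocalRealified
import Literature.IUT.HodgeTheaters.PiAvatarBadPairAtStandIn
import Literature.IUT.HodgeTheaters.InitialThetaDataArrowOpenProofs
import Literature.IUT.HodgeTheaters.InitialThetaDataLocalGroupsPlaceProofs
import Literature.IUT.HodgeTheaters.InitialThetaDataLocalPuncturedData
import HarnessLib

/-!
# R59 «MERGEINPUTS-NV» (m2 half + m4): the Ex. 3.2 group datum of the merge record INHABITED at ONE explicit MODEL datum —
# the `X̲→`-profinite stand-in `B := badPairAtArrow hA` — with GENUINE augmentation and DEGENERATE `Ÿ`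

S. Mochizuki, *Inter-universal Teichmüller theory I*, kurims manuscript (May 2020), Def. 3.1 (e)(f) pp. 62–63 («the natural outer
surjections onto the decomposition group `G_v̲ ⊆ G_K`»; «if `v̲ ∈ V̲^good`, then … `Π_v̲ := Π_{X̲→_v̲}`»), Example 3.2 (i) p. 70, (ii) p. 70
(«the tempered covering `Ÿ_v → X̲̲_v`»), (v) p. 72 («the base field of `Ÿ_v` is equal to `K_v`») ([IUTchI] Def 3.1 (e) p.62)
[claim: Mochizuki2012, status: disputed] (D-0012 claim key, series status DISPUTED — a CONSTRUCTION over abc-iut-L5-t2's REAL `InitialThetaData`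
and landed theorems; nothing of the series is asserted; no side is taken on [IUTchIII] Cor. 3.12).

PURPOSE (abc-iut-L5-lead RULINGS #119 (2), row R59, flip condition (b) for the «mod I» Ex. 3.2 candidates at the merge record
`InitialThetaData.MergeInputs D B`, ★ p496697): inhabit the fields of the record at ONE explicit datum, MODEL allowed and LABELLED.
* (m4) — DONE in `GenuineFKitOfBadLocalRealified.lean` (★ p497530): `realifiedGlobalSideOfModuli D` = `𝒞⊩_mod` BY NAME (L1 R173).
* (m2) — HERE, at the `X̲→`-PROFINITE STAND-IN bad-pair family `B := fun x _ => D.badPairAtArrow hA x` (abc-iut-L5-t4/w5-d129, the D-JΘ1-2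
  repair path of record: `H = Π_{X̲→_K} ∩ augGF⁻¹ G_v̲`, NOT print's `Π^tp_{X̳_v̲}`): **`m2StandIn … x hx : BadLocalGroupDatum (D.GalAt x _) ↥(D.badPairAtArrow hA x).H`**
  with **GENUINE augmentation** `aug := Π_{X̲→_K} ∩ augGF⁻¹ G_v̲ ≅ Π_{X̲→_K} ×_{G_K} Gal(K̄_w/K_w) ↠ Gal(K̄_w/K_w)` — abc-iut-L5-t2 gen 4/5: the base change
  `PiLoc`/`augLoc` (p418415), `fstLoc` injective at a completion (p420479), `augLoc` SURJECTIVE and OPEN (p425530, from the §1 openness clause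
  `ArrowOpenClaims`, itself from `hA` + FACT F-0240 `GeomTFG` + `CG`, abc-iut-L5-t2 `arrowOpenClaims_pe_of_geomTFG`), transported along the
  bicontinuous identification `standInEquiv : ↥H ≃ₜ* Π_{X̲→_K} ×_{G_K} Gal(K̄_w/K_w)` (continuous bijection from a compact space to a Hausdorff one) —
  and **DEGENERATE covering `Π_Ÿ := Π_v̲`** («no double cover»: `map_Y` from surjectivity).  LABEL «[m2 MODEL at the `X̲→`-stand-in: aug genuine,
  `Ÿ` degenerate; NOT the tempered `Π^tp_{X̳_v̲} ⊇ Π^tp_{Ÿ_v̲}` of print]».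
* (m1) — NOT here: abc-iut-L5-t2's `TemperedThetaInput.trivial` (p441995) exists only over the DEGENERATE group datum `aug = id` and does not
  generalise to a datum with non-injective `aug` (the Frobenius-trivial object `T_A` cannot be total over `𝒟_v` when `𝒞^Θ` lives over `𝒟^Θ ⊊ 𝒟_v`);
  the residual is recorded as the exact Lean type `MergeInputsNVResidual` = «an inhabitant of `D.BadTemperedSide B x hx (m2StandIn x hx)` at
  every bad index» (L2 producer, RULINGS #119 (1)(i)), and `mergeInputs_of_residual` assembles the record from it.
BINDER CENSUS: {`D`, `hA`, `CG`, `hTFG` (FACT F-0240 by name), `x`, `hx`}; LAW 0 beyond the kit's own `hA`/`CG`; no instance, no notation, no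
`sorry`.  typed ≠ inhabited ≠ proved; nothing here asserts abc proved or refuted.
-/

noncomputable section

namespace Literature.IUT.HodgeTheaters

open CategoryTheory _root_.NumberField _root_.IsDedekindDomain Literature.NumberTheory.NumberFields
  Literature.AlgebraicGeometry.Frobenioids Literature.AlgebraicGeometry.Frobenioids.PadicFrd
  Literature.AnabelianGeometry.SemiGraphs Topology

variable {F K Fbar : Type} [Field F] [NumberField F] [Field K] [NumberField K] [Algebra F K]
  [Field Fbar] [Algebra F Fbar] [Algebra K Fbar] {E : WeierstrassCurve F}
  [E.IsElliptic] {l : ℕ} {Pb : BadPlacePredicates K} (D : InitialThetaData F K Fbar E l Pb)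

namespace InitialThetaData

/-! ### The local Galois representation at a nonarchimedean index (`RescaledCompletion` spelling of the merge record) -/

section LocalRep

variable (x : D.IndexCopy) (hx : x ∉ D.indexCopyArc)

/-- `Gal(K̄_v̲/K_v̲) → G_F` at a nonarchimedean index (`localToGF` along the chosen embedding `F̄ → K̄_v̲`, abc-iut-L5-t2 p417875) for
`K_v̲ := RescaledCompletion K p_v̲ w _` — the Galois group `D.GalAt x` of the merge record. ([IUTchI] Def 3.1 (e) p.62) [claim: Mochizuki2012, status: disputed] -/
def rhoAt : (AlgebraicClosure (RescaledCompletion K (D.primeAt x hx) (D.specAt x hx) (D.primeAt_mem x hx)) ≃ₐ[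
      RescaledCompletion K (D.primeAt x hx) (D.specAt x hx) (D.primeAt_mem x hx)]
      AlgebraicClosure (RescaledCompletion K (D.primeAt x hx) (D.specAt x hx) (D.primeAt_mem x hx))) →* (Fbar ≃ₐ[F] Fbar) :=
  haveI := D.isScalarTower
  haveI := D.normal_K
  letI : Algebra K (RescaledCompletion K (D.primeAt x hx) (D.specAt x hx) (D.primeAt_mem x hx)) :=
    inferInstanceAs (Algebra K ((D.specAt x hx).adicCompletion K))
  localToGF F (RescaledCompletion K (D.primeAt x hx) (D.specAt x hx) (D.primeAt_mem x hx))
    (localEmb (K := K) (Fbar := Fbar) (AlgebraicClosure (RescaledCompletion K (D.primeAt x hx) (D.specAt x hx) (D.primeAt_mem x hx))))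

/-- **The decomposition group of the kit at a nonarchimedean index IS the image of `Gal(K̄_v̲/K_v̲) → G_F`** (`decompAt x = (rhoAt x).range`:
abc-iut-L5-t4's `decompAt` evaluated at `indexCopyVal x = Sum.inr (finPlaceAt x)`). ([IUTchI] Def 3.1 (e) p.62) [claim: Mochizuki2012, status: disputed] -/
theorem decompAt_eq_range_rhoAt : D.decompAt x = (D.rhoAt x hx).range := by
  have h := D.indexCopyVal_eq_inr x hx
  unfold decompAt
  split
  · next a ha => exact absurd (ha ▸ h) Sum.inl_ne_inr
  · next w hw =>
    rw [hw] at h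
    cases Sum.inr_injective h
    rfl

/-- `Π_{X̲→_K} ×_{G_K} Gal(K̄_v̲/K_v̲) ↠ Gal(K̄_v̲/K_v̲)` is SURJECTIVE (abc-iut-L5-t2 `augLoc_PiXarrow_localToGF_surjective`, p425530).
([IUTchI] Def 3.1 (e) p.62) [claim: Mochizuki2012, status: disputed] -/
theorem augLoc_rhoAt_surjective : Function.Surjective (D.augLoc D.PiXarrow (D.rhoAt x hx)) := by
  haveI := D.isScalarTower
  haveI := D.normal_K
  letI : Algebra K (RescaledCompletion K (D.primeAt x hx) (D.specAt x hx) (D.primeAt_mem x hx)) :=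
    inferInstanceAs (Algebra K ((D.specAt x hx).adicCompletion K))
  exact D.augLoc_PiXarrow_localToGF_surjective (RescaledCompletion K (D.primeAt x hx) (D.specAt x hx) (D.primeAt_mem x hx))
    (localEmb (K := K) (Fbar := Fbar) (AlgebraicClosure (RescaledCompletion K (D.primeAt x hx) (D.specAt x hx) (D.primeAt_mem x hx))))

/-- `Π_{X̲→_K} ×_{G_K} Gal(K̄_v̲/K_v̲) ↠ Gal(K̄_v̲/K_v̲)` is OPEN, given the §1 openness clause (abc-iut-L5-t2 `isOpenMap_augLoc_PiXarrow_of_arrowOpenClaims`).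
([IUTchI] Def 3.1 (f) p.63) [claim: Mochizuki2012, status: disputed] -/
theorem isOpenMap_augLoc_rhoAt (h : D.geom.pe.ArrowOpenClaims) : IsOpenMap (D.augLoc D.PiXarrow (D.rhoAt x hx)) := by
  haveI := D.isScalarTower
  haveI := D.normal_K
  letI : Algebra K (RescaledCompletion K (D.primeAt x hx) (D.specAt x hx) (D.primeAt_mem x hx)) :=
    inferInstanceAs (Algebra K ((D.specAt x hx).adicCompletion K))
  exact D.isOpenMap_augLoc_PiXarrow_of_arrowOpenClaims (RescaledCompletion K (D.primeAt x hx) (D.specAt x hx) (D.primeAt_mem x hx))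
    (localEmb (K := K) (Fbar := Fbar) (AlgebraicClosure (RescaledCompletion K (D.primeAt x hx) (D.specAt x hx) (D.primeAt_mem x hx)))) h

/-- `Π_{X̲→_K} ×_{G_K} Gal(K̄_v̲/K_v̲)` is PROFINITE (compact), given the §1 openness clause (abc-iut-L5-t2 `compactSpace_PiLoc_PiXarrow_of_arrowOpenClaims`;
`F̄/F` integral from the datum). ([IUTchI] Def 3.1 (f) p.63) [claim: Mochizuki2012, status: disputed] -/
theorem compactSpace_PiLoc_rhoAt [Fact (D.primeAt x hx).Prime] (h : D.geom.pe.ArrowOpenClaims) :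
    CompactSpace (D.PiLoc D.PiXarrow (D.rhoAt x hx)) := by
  haveI := D.isScalarTower
  haveI := D.normal_K
  haveI := D.isIntegral_F
  letI : Algebra K (RescaledCompletion K (D.primeAt x hx) (D.specAt x hx) (D.primeAt_mem x hx)) :=
    inferInstanceAs (Algebra K ((D.specAt x hx).adicCompletion K))
  haveI : CharZero (RescaledCompletion K (D.primeAt x hx) (D.specAt x hx) (D.primeAt_mem x hx)) :=
    charZero_of_injective_algebraMap (algebraMap K _).injective
  exact D.compactSpace_PiLoc_PiXarrow_of_arrowOpenClaims (RescaledCompletion K (D.primeAt x hx) (D.specAt x hx) (D.primeAt_mem x hx))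
    (localEmb (K := K) (Fbar := Fbar) (AlgebraicClosure (RescaledCompletion K (D.primeAt x hx) (D.specAt x hx) (D.primeAt_mem x hx)))) h

end LocalRep

/-! ### (m2) at the `X̲→`-profinite stand-in: `Π_{X̲→_K} ∩ augGF⁻¹ G_v̲ ≅ Π_{X̲→_K} ×_{G_K} Gal(K̄_v̲/K_v̲) ↠ Gal(K̄_v̲/K_v̲)` -/

section StandIn

variable (hA : D.geom.pe.ArrowCoveringClaims) (CG : D.geom.pe.CuspGalois) (hTFG : D.geom.extF.GeomTFG)
  (x : D.IndexCopy) (hx : x ∉ D.indexCopyArc)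

/-- The image of `Π_{X̲→_K} ×_{G_K} Gal(K̄_v̲/K_v̲) → Π_{C_F}` IS the stand-in's local group `Π_{X̲→_K} ∩ augGF⁻¹ G_v̲` (abc-iut-L5-t2 `range_fstLoc`
+ `decompAt_eq_range_rhoAt`). ([IUTchI] Def 3.1 (f) p.63) [claim: Mochizuki2012, status: disputed] -/
theorem range_fstLoc_rhoAt :
    (D.fstLoc D.PiXarrow (D.rhoAt x hx)).range = D.PiXarrow ⊓ (D.decompAt x).comap D.augGF := by
  rw [D.range_fstLoc, D.decompAt_eq_range_rhoAt x hx]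

/-- `Π_{X̲→_K} ×_{G_K} Gal(K̄_v̲/K_v̲) → Π_{X̲→_K} ∩ augGF⁻¹ G_v̲ = (badPairAtArrow hA x).H`, the first projection co-restricted.
([IUTchI] Def 3.1 (f) p.63) [claim: Mochizuki2012, status: disputed] -/
def standInHom : D.PiLoc D.PiXarrow (D.rhoAt x hx) →* ↥(D.badPairAtArrow hA x).H :=
  (D.fstLoc D.PiXarrow (D.rhoAt x hx)).codRestrict _ fun z => by
    rw [badPairAtArrow_H, ← D.range_fstLoc_rhoAt x hx]
    exact ⟨z, rfl⟩

/-- `standInHom` is the first projection on underlying elements. ([IUTchI] Def 3.1 (f) p.63) [claim: Mochizuki2012, status: disputed] -/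
theorem coe_standInHom (z : D.PiLoc D.PiXarrow (D.rhoAt x hx)) :
    ((D.standInHom hA x hx z : ↥(D.badPairAtArrow hA x).H) : D.PiC) = D.fstLoc D.PiXarrow (D.rhoAt x hx) z := rfl

/-- `standInHom` is BIJECTIVE: injective because `Gal(K̄_v̲/K_v̲) → G_F` is (`K` dense in the complete `K_v̲`, abc-iut-L5-t2 p420479
`fstLoc_injective_adicCompletion`), surjective by `range_fstLoc_rhoAt`. ([IUTchI] Def 3.1 (e) p.62) [claim: Mochizuki2012, status: disputed] -/
theorem standInHom_bijective : Function.Bijective (D.standInHom hA x hx) := by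
  haveI := D.isScalarTower
  haveI := D.normal_K
  haveI := D.isAlgClosed
  refine ⟨fun z z' h => ?_, fun y => ?_⟩
  · have h' : D.fstLoc D.PiXarrow (D.rhoAt x hx) z = D.fstLoc D.PiXarrow (D.rhoAt x hx) z' := by
      rw [← coe_standInHom, ← coe_standInHom, h]
    exact D.fstLoc_injective_adicCompletion D.PiXarrow (D.specAt x hx) _ h'
  · have hy : (y : D.PiC) ∈ (D.fstLoc D.PiXarrow (D.rhoAt x hx)).range := by
      rw [D.range_fstLoc_rhoAt x hx]; exact y.2
    obtain ⟨z, hz⟩ := hy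
    exact ⟨z, Subtype.ext hz⟩

/-- **`Π_{X̲→_K} ×_{G_K} Gal(K̄_v̲/K_v̲) ≃ₜ* Π_{X̲→_K} ∩ augGF⁻¹ G_v̲`** — the bijective continuous homomorphism `standInHom` from a compact group to a
Hausdorff one is bicontinuous. ([IUTchI] Def 3.1 (e)(f) pp.62-63) [claim: Mochizuki2012, status: disputed] -/
def standInEquiv [Fact (D.primeAt x hx).Prime] : D.PiLoc D.PiXarrow (D.rhoAt x hx) ≃ₜ* ↥(D.badPairAtArrow hA x).H :=
  haveI := D.compactSpace_PiLoc_rhoAt x hx (D.arrowOpenClaims_pe_of_geomTFG hA hTFG CG)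
  let e : D.PiLoc D.PiXarrow (D.rhoAt x hx) ≃ ↥(D.badPairAtArrow hA x).H := Equiv.ofBijective _ (D.standInHom_bijective hA x hx)
  have he : Continuous e := (D.continuous_fstLoc D.PiXarrow (D.rhoAt x hx)).subtype_mk _
  { MulEquiv.ofBijective (D.standInHom hA x hx) (D.standInHom_bijective hA x hx) with
    continuous_toFun := he
    continuous_invFun := (he.homeoOfEquivCompactToT2 (f := e)).symm.continuous }

/-- `standInEquiv` is `standInHom` on elements. ([IUTchI] Def 3.1 (f) p.63) [claim: Mochizuki2012, status: disputed] -/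
theorem standInEquiv_apply [Fact (D.primeAt x hx).Prime] (z : D.PiLoc D.PiXarrow (D.rhoAt x hx)) :
    D.standInEquiv hA CG hTFG x hx z = D.standInHom hA x hx z := rfl

/-- **(m2) AT THE `X̲→`-PROFINITE STAND-IN — «[MODEL: aug genuine, `Ÿ` degenerate]»**: the [IUTchI] Ex. 3.2 group datum on the stand-in's
`Π_v̲ = Π_{X̲→_K} ∩ augGF⁻¹ G_v̲` with GENUINE augmentation `Π_v̲ ≅ Π_{X̲→_K} ×_{G_K} Gal(K̄_v̲/K_v̲) ↠ Gal(K̄_v̲/K_v̲)` (continuous; OPEN and SURJECTIVE by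
abc-iut-L5-t2 p425530/p419029) and DEGENERATE covering `Π_Ÿ := Π_v̲` («no double cover»; NOT print's tempered `Π^tp_{Ÿ_v̲} ⊊ Π^tp_{X̳_v̲}`).
([IUTchI] Ex 3.2 (i)(ii)(v) pp.70-72) [claim: Mochizuki2012, status: disputed] -/
def m2StandIn [Fact (D.primeAt x hx).Prime] : BadLocalGroupDatum (D.GalAt x hx) ↥(D.badPairAtArrow hA x).H :=
  { aug := (D.augLoc D.PiXarrow (D.rhoAt x hx)).comp (D.standInEquiv hA CG hTFG x hx).symm.toMonoidHom
    continuous_aug := (D.continuous_augLoc D.PiXarrow (D.rhoAt x hx)).comp (D.standInEquiv hA CG hTFG x hx).symm.continuous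
    isOpenMap_aug := (D.isOpenMap_augLoc_rhoAt x hx (D.arrowOpenClaims_pe_of_geomTFG hA hTFG CG)).comp
      (D.standInEquiv hA CG hTFG x hx).symm.toHomeomorph.isOpenMap
    Y := ⊤
    map_Y := by
      rw [OpenSubgroup.toSubgroup_top]
      exact Subgroup.map_top_of_surjective _
        ((D.augLoc_rhoAt_surjective x hx).comp (D.standInEquiv hA CG hTFG x hx).symm.surjective) }

/-- Its `Π_Ÿ` is all of `Π_v̲` (the degenerate covering). ([IUTchI] Ex 3.2 (ii) p.70) [claim: Mochizuki2012, status: disputed] -/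
theorem m2StandIn_Y [Fact (D.primeAt x hx).Prime] : (D.m2StandIn hA CG hTFG x hx).Y = ⊤ := rfl

/-- Its augmentation is the GENUINE `Π_{X̲→_K} ×_{G_K} Gal(K̄_v̲/K_v̲) ↠ Gal(K̄_v̲/K_v̲)` transported along `standInEquiv`.
([IUTchI] Def 3.1 (e) p.62) [claim: Mochizuki2012, status: disputed] -/
theorem m2StandIn_aug [Fact (D.primeAt x hx).Prime] :
    (D.m2StandIn hA CG hTFG x hx).aug = (D.augLoc D.PiXarrow (D.rhoAt x hx)).comp (D.standInEquiv hA CG hTFG x hx).symm.toMonoidHom := rfl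

end StandIn

/-! ### The merge record modulo the (m1) residual -/

section Record

variable (hA : D.geom.pe.ArrowCoveringClaims) (CG : D.geom.pe.CuspGalois) (hTFG : D.geom.extF.GeomTFG)

/-- **The exact (m1) residual of R59 at the stand-in** — an inhabitant of the [EtTh] §5 tempered side over `m2StandIn` at every bad index
(the L2 producer of RULINGS #119 (1)(i)); the one field of the merge record NOT inhabited in the tree. ([IUTchI] Ex 3.2 (i) p.70) [claim: Mochizuki2012, status: disputed] -/
def MergeInputsNVResidual : Type 1 :=
  ∀ x (hx : x ∈ D.indexCopyBad),
    haveI : Fact (D.primeAt x (D.not_mem_arc_of_mem_bad hx)).Prime := D.fact_primeAt_prime x _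
    D.BadTemperedSide (fun v _ => D.badPairAtArrow hA v) x hx (D.m2StandIn hA CG hTFG x (D.not_mem_arc_of_mem_bad hx))

/-- **R59 at the stand-in: the merge record assembled from (m2) `m2StandIn`, (m4) `𝒞⊩_mod` by name, FACT F-0240, and the (m1) residual.**
([IUTchI] Def 5.2 (i)-(iv) pp.134-135) [claim: Mochizuki2012, status: disputed] -/
def mergeInputs_of_residual (R : D.MergeInputsNVResidual hA CG hTFG) : D.MergeInputs fun v _ => D.badPairAtArrow hA v where
  m2 x hx :=
    haveI : Fact (D.primeAt x (D.not_mem_arc_of_mem_bad hx)).Prime := D.fact_primeAt_prime x _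
    D.m2StandIn hA CG hTFG x (D.not_mem_arc_of_mem_bad hx)
  m1 := R
  m4 := D.realifiedGlobalSideOfModuli
  geomTFG := hTFG

/-- The residual is the ONLY missing inhabitant: `Nonempty` of it gives `Nonempty (MergeInputs …)` at the stand-in.
([IUTchI] Def 5.2 (i) p.134) [claim: Mochizuki2012, status: disputed] -/
theorem nonempty_mergeInputs_standIn_of_residual (h : Nonempty (D.MergeInputsNVResidual hA CG hTFG)) :
    Nonempty (D.MergeInputs fun v _ => D.badPairAtArrow hA v) :=
  h.map (D.mergeInputs_of_residual hA CG hTFG)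

end Record


end InitialThetaData

end Literature.IUT.HodgeTheaters

end
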